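import Summits.AtomisticToContinuum.FouriersLaw.Theses.OddSectorIrreversibility
import Literature.MathematicalPhysics.KineticTheory.LangevinChainGibbs
import Literature.Barriers.AtomisticToContinuum.HarmonicCrystalBallisticProofs

/-!
# Disproof workfile for crux `OddResponseBound` (stmt-AtomisticToContinuum-9140, "SI")

`SI`: under weak-NESS uniqueness, along the steady-state family `μ`, for every `T > 0` there is `C`
with `a_N := N · ∫ (h_N − h_N∘Θ)² dμ_{N,T,T} ≤ C` for all `N ≥ 2` and every `L²` linear-response
density `h_N` of `δ ↦ μ_{N,T+δ/2,T−δ/2}` (`Θ (q,p) = (q,−p)`).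

## Findings (refuter-cdisprove seat, cycle 1, 2026-08-16) — provers please read §0–§4

§0 ELABORATION / SHAPE. rc 0 (probe below). Quantifier order matches the informal text; `C` may
depend on the parameters, on the family `μ` (pinned down by the uniqueness antecedent anyway) and on
`T`. `h` is determined `μ_T`-a.e. by clause 2 of its predicate (smooth compactly supported
observables separate finite measures), so `∀ h` hides no junk freedom; `h (x.1, -x.2)` is then
determined a.e. because `μ_T` = Gibbs `≪≫` Lebesgue and `Θ` preserves Lebesgue. `N = 0, 1` are
excluded (`2 ≤ N`) but would be harmless (`h = 0` a.e. at `N = 1`: both baths sit on one site at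
`(T_L+T_R)/2 = T`). NO CHEAP KILL EXISTS: `¬SI` needs (i) the uniqueness antecedent PROVED for the
chosen parameters (= item NessUnique, stmt-0741, open) and (ii) quantitative control of the true
NESS response density of an anharmonic chain. Everything below is therefore either an abstract
lemma, a statement about solvable calibration models, or a conditional.

§1 THE ONE INEQUALITY (proved below, `four_mul_sq_integral_le`): for a `Θ`-invariant measure, an
odd `g ∈ L²` and `h ∈ L²`, `4 (∫ g h)² ≤ (∫ g²) · ∫ (h − h∘Θ)²`. Read two ways:
 * positive (OddSufficiency, tightness): with `g = J_tot`, `∫ J_tot h = D_N`, `∫ J_tot² ≤ c N`: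
   `a_N ≥ 4 N D_N² / (c N) = 4 D_N²/c` — under Fourier (`D_N → κ > 0`) the power `N¹` in SI is
   OPTIMAL (`N^{1+ε} ∫(h−hΘ)²` is unbounded); `oddResponse_floor` below.
 * negative (every echo/causal-transport lower bound): ANY odd test functions `G_N` with
   `N (∫ G_N h_N)² / ∫ G_N² → ∞` refute SI.

§2 LOAD-BEARING HYPOTHESES. `0 < lam`, `0 < β` are jointly load-bearing: for the harmonic member
`pinnedChain ω₂ 0 0 γ` (RLL Gaussian NESS `harmonicNESS`, in tree) EXACT linear algebra gives
`∫(h−hΘ)² dμ_T = 0.678, 0.939, 1.562, 2.223, 2.889, 3.556` for `N = 3,4,6,8,10,12`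
(`ω₂ = γ = T = 1`; two independent routes agree to 1e-12: Gaussian density derivative
`4 tr(Zᵀ Φ Z)/T²` and the Kubo-corrector identity `h − hΘ = (u − uΘ)/((N−1)T²)`, folder
`purepy_flip.py`, kit job j007912), i.e. `a_N ≈ 0.30 N² → ∞`. Formal status:
`oddResponseBoundHarmonic_false_of` below refutes the `lam = β = 0` analogue (stated for EVERY
steady-state family, so that NESS uniqueness is not needed) MODULO two inputs recorded as hypotheses:
existence of the Gaussian response density (`HarmonicResponseDensity`, the harmonic twin of item
ResponseDensity) and one fourth Gaussian moment (`HarmonicCurrentVariance`, twin of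
CurrentVarianceLinear for one bond). Which of `lam > 0` / `β > 0` alone suffices is open
(`β = 0, lam > 0` is the φ⁴ chain, whose NESS existence is open for `N ≥ 4`).

§3 WHY SI IS PROBABLY FALSE FOR THE DETERMINISTIC CHAIN (agrees with crux idea
`causal-transport-of-h`, TRIAGE-r1-1). Exact representation (generalised detailed balance
`L† = ΘLΘ`, valid for pinnedChain): `h − h∘Θ = (u − u∘Θ)/((N−1)T²)` with
`(u − u∘Θ)(x) = E[∫_{−∞}^{∞} J_tot(X_t) dt | X_0 = x]`, `X` the EQUILIBRIUM bath process. Hence for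
any odd `Y ∈ L²(μ_T)` that is a FUNCTION OF `X_0`: `‖u − uΘ‖ ≥ E[Y · ∫J_tot dt]/‖Y‖`. For a
deterministic bulk, `Y := ∫_{−τ}^{τ} J_bulk(Φ_s X_0) ds` (ISOLATED Hamiltonian flow `Φ`, bonds at
distance `> vτ` from the contacts, `τ = bN` inside the causal cone) is `X_0`-measurable and equals
the bath-process integral pathwise, so numerator AND denominator are the same Green–Kubo quantity:
`E[Y ∫J] ≈ 4τ N_b κ T²`, `‖Y‖² ≈ 4τ N_b κ T²` (Einstein–Helfand, `τ_mic ≪ τ ≪ N²`), giving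
`‖u−uΘ‖² ≳ 4 b N² κ T² (1−2vb)`, `∫(h−hΘ)² ≳ 4bκ(1−2vb)/T²`, **`a_N ≳ const · N`**. For a STOCHASTIC
bulk the conditional expectation `E[∫J ds | X_0]` collapses to `≈ τ_mic J_tot(X_0)` and `a_N = O(1)`.
So SI ∧ (normal conduction of the deterministic chain: finite signal speed in `L²(Gibbs)`,
Green–Kubo/Einstein–Helfand for bulk currents, `D_N ↛ 0`) is heuristically CONTRADICTORY: the
route's X is in tension with its own target. Inputs that are open and would make this a proof:
NessUnique, ResponseDensity, an `L²(Gibbs)` Lieb–Robinson bound for pinnedChain with `β > 0`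
(BCDM math-ph/0607023 covers quartic pinning + harmonic coupling only), GK asymptotics.
The static reversal entropy therefore scales `b_N = KL(μ_δ‖Θμ_δ) ≍ δ²·{N (ballistic) | 1
(deterministic diffusive) | N⁻¹ (stochastic diffusive)}`, not `δ²/N`, for pinnedChain.

§4 STOCHASTIC-BULK CALIBRATION (exact, this seat): harmonic chain + energy-conserving velocity
flips at rate `λ` on every site (Bernardin–Olla / Dhar–Venkateshan–Lebowitz model; Fourier's law
proved), Langevin ends, `ω₂ = γ = T = 1`; the Kubo corrector is an exact quadratic form solving a
generalised Sylvester equation, so `a_N` is exact: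
`λ = 1: a_N = 0.1715, 0.1776, 0.1837, 0.1862, 0.1874, 0.1882, 0.1887, 0.1890 (N = 3,4,6,8,10,12,14,16)
→ ≈ 0.19`, Cauchy–Schwarz floor `4N D_N²/‖J‖² = 0.18` (95 % of `h_odd` lies along `J_tot`);
`λ = 0.5: a_N ↗ 0.69`; `λ = 2: a_N ↘ 0.0495`; `λ = 0` (harmonic): `a_N = 0.30 N²`. SI holds sharply
in both stochastic-bulk benchmarks (this and the planner's BLL self-consistent chain, `a_N → 0.78`)
— which, by §3, is NOT evidence for the deterministic chain: both lack a deterministic bulk.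

§5 WHAT A PROOF OF SI WOULD HAVE TO USE (census for provers): anharmonicity (§2); something that
kills the `X_0`-measurability of time-integrated bulk currents over times `≍ N` (§3) — i.e. a
mechanism absent in every Hamiltonian bulk; the uniqueness antecedent only to identify `μ_T` with
Gibbs. My assessment: SI is false for pinnedChain; the defensible sibling is the `O(1)` statement
`∫(h−hΘ)² ≤ C` (i.e. `b_N = O(δ²)`), which still separates from the ballistic `≍ N` but NO LONGER
gives HasBoundedResponse by the one-line Cauchy–Schwarz (it gives only `D_N = O(√N)`).

§6 KERNEL-CHECKED CONTENT OF THIS FILE AND WHAT HAS LANDED (all sorry-free, standard axioms):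
 * LANDED `Theorems/OddResponseBound/Negative/OddPairing.lean` (p73182, commit 8d7267c2fdb8): §1/§1b
   (`four_mul_sq_integral_le`, `oddResponse_floor`), §2 (`measurePreserving_momentumReversal_harmonicNESS`,
   `harmonic_oddResponse_floor`, `harmonic_oddResponse_exceeds` — the harmonic analogue of SI fails as
   soon as Gaussian response densities exist, given one N-uniform fourth moment).
 * PROPOSED `Theorems/OddResponseBound/Negative/EchoFloor.lean` (p73549): §3 as two theorems —
   `corrector_oddNormSq_le_of_oddResponseBound` (SI ∧ NessUnique ∧ ResponseDensity ∧
   OddDensityIsCorrector ⇒ `‖u_N − u_N∘Θ‖²_{L²(Gibbs)} ≤ C((N−1)T²)²/N = O(N)`: SI's falsifiable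
   EQUILIBRIUM prediction) and `oddResponseBound_false_of_echoFloor` (an equilibrium floor `cN²`
   refutes SI given the same three support items). In this file: `EquilibriumEchoFloor` (named) and
   the same theorem.
 * The MD job j008869 measures a rigorous-in-form lower bound `‖u−uΘ‖² ≥ 4A²/‖Y‖²` with the echo
   test function; `≍ N²` confirms §3 and kills SI numerically, `O(N)` would rescue it.

-- Targets: none yet (payload.targets = []).
-/

noncomputable section

namespace Summit.AtomisticToContinuum.FouriersLaw.Cruxes.OddResponseBound.Disproof

open MeasureTheory Filter Topology
open Literature.MathematicalPhysics.KineticTheory.HeatConduction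
open Summit.AtomisticToContinuum.FouriersLaw.Theses.OddSectorIrreversibility

/-! ## §0 probe -/

/-- The crux elaborates and has the displayed shape (refuter probe, rc 0). -/
theorem probe_shape : OddResponseBound ↔
    ∀ ω₂ lam β γ : ℝ, 0 < ω₂ → 0 < lam → 0 < β → 0 < γ →
    (∀ (N : ℕ) (T_L T_R : ℝ), 0 < T_L → 0 < T_R → ∀ μ ν : Measure (PhaseSpace N),
      (pinnedChain ω₂ lam β γ).IsSteadyState N T_L T_R μ →
      (pinnedChain ω₂ lam β γ).IsSteadyState N T_L T_R ν → μ = ν) →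
    ∀ μ : (N : ℕ) → ℝ → ℝ → Measure (PhaseSpace N),
    (∀ (N : ℕ) (T_L T_R : ℝ), 0 < T_L → 0 < T_R →
      (pinnedChain ω₂ lam β γ).IsSteadyState N T_L T_R (μ N T_L T_R)) →
    ∀ T : ℝ, 0 < T → ∃ C : ℝ, ∀ (N : ℕ) (h : PhaseSpace N → ℝ), 2 ≤ N →
      (MemLp h 2 (μ N T T) ∧
        (∀ F : PhaseSpace N → ℝ, ContDiff ℝ ((⊤ : ℕ∞) : WithTop ℕ∞) F → HasCompactSupport F →
          Tendsto (fun δ : ℝ => ((∫ x, F x ∂(μ N (T + δ / 2) (T - δ / 2))) - ∫ x, F x ∂(μ N T T)) / δ)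
            (𝓝[≠] 0) (𝓝 (∫ x, F x * h x ∂(μ N T T)))) ∧
        (∀ i : Fin N, Tendsto (fun δ : ℝ =>
            ((∫ x, (pinnedChain ω₂ lam β γ).bondCurrent N i x ∂(μ N (T + δ / 2) (T - δ / 2))) -
              ∫ x, (pinnedChain ω₂ lam β γ).bondCurrent N i x ∂(μ N T T)) / δ)
            (𝓝[≠] 0) (𝓝 (∫ x, (pinnedChain ω₂ lam β γ).bondCurrent N i x * h x ∂(μ N T T))))) →
      MemLp (fun x : PhaseSpace N => h x - h (x.1, -x.2)) 2 (μ N T T) ∧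
        (N : ℝ) * ∫ x, (h x - h (x.1, -x.2)) ^ 2 ∂(μ N T T) ≤ C :=
  Iff.rfl

/-! ## §1 the odd-sector pairing inequality (abstract; Θ-transfer + Cauchy–Schwarz) -/

section OddPairing

variable {X : Type*} [MeasurableSpace X] {μ : Measure X}

/-- Cauchy–Schwarz for real square-integrable functions (discriminant proof).
`(∫ g k)² ≤ (∫ g²)(∫ k²)`. [folklore] -/
theorem sq_integral_mul_le {g k : X → ℝ} (hg : MemLp g 2 μ) (hk : MemLp k 2 μ) :
    (∫ x, g x * k x ∂μ) ^ 2 ≤ (∫ x, g x ^ 2 ∂μ) * ∫ x, k x ^ 2 ∂μ := by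
  have hg2 : Integrable (fun x => g x ^ 2) μ := hg.integrable_sq
  have hk2 : Integrable (fun x => k x ^ 2) μ := hk.integrable_sq
  have hgk : Integrable (fun x => g x * k x) μ := hg.integrable_mul hk
  set A := ∫ x, g x ^ 2 ∂μ with hA_def
  set B := ∫ x, g x * k x ∂μ with hB_def
  set C := ∫ x, k x ^ 2 ∂μ with hC_def
  have hA : 0 ≤ A := integral_nonneg fun x => sq_nonneg _
  have key : ∀ t : ℝ, 0 ≤ A * t ^ 2 - 2 * B * t + C := by
    intro t
    have h1 : 0 ≤ ∫ x, (t * g x - k x) ^ 2 ∂μ := integral_nonneg fun x => sq_nonneg _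
    have h2 : ∫ x, (t * g x - k x) ^ 2 ∂μ = A * t ^ 2 - 2 * B * t + C := by
      have hsplit : (fun x => (t * g x - k x) ^ 2) =
          fun x => (t ^ 2 * g x ^ 2 - 2 * t * (g x * k x)) + k x ^ 2 := by
        funext x; ring
      have i1 : Integrable (fun x => t ^ 2 * g x ^ 2 - 2 * t * (g x * k x)) μ :=
        (hg2.const_mul _).sub (hgk.const_mul _)
      rw [hsplit, integral_add i1 hk2, integral_sub (hg2.const_mul _) (hgk.const_mul _),
        integral_const_mul, integral_const_mul]
      ring
    linarith
  by_cases hA0 : A = 0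
  · have hB : B = 0 := by
      by_contra hB
      have h := key ((C + 1) / (2 * B))
      have h' : (2 : ℝ) * B * ((C + 1) / (2 * B)) = C + 1 := by
        field_simp
      rw [hA0, zero_mul, zero_sub, h'] at h
      linarith
    rw [hB, hA0]
    simp
  · have hApos : 0 < A := lt_of_le_of_ne hA (Ne.symm hA0)
    have h := key (B / A)
    have h3 : A * (B / A) ^ 2 - 2 * B * (B / A) + C = C - B ^ 2 / A := by
      field_simp
      ring
    rw [h3] at h
    have h4 : B ^ 2 / A ≤ C := by linarith
    rw [div_le_iff₀ hApos] at h4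
    linarith [h4]

variable {Θ : X → X}

/-- Θ-transfer: for a `Θ`-invariant measure, an involutive measurable `Θ` and an odd `g`,
`∫ g · (h∘Θ) = −∫ g · h`. [folklore] -/
theorem integral_mul_comp_eq_neg (hΘ : MeasurePreserving Θ μ μ) (hΘm : Measurable Θ)
    (hinv : Function.Involutive Θ) {g h : X → ℝ} (hodd : ∀ x, g (Θ x) = -g x) :
    ∫ x, g x * h (Θ x) ∂μ = -∫ x, g x * h x ∂μ := by
  have hemb : MeasurableEmbedding Θ :=
    (⟨⟨Θ, Θ, hinv.leftInverse, hinv.rightInverse⟩, hΘm, hΘm⟩ : X ≃ᵐ X).measurableEmbedding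
  -- substitute `x ↦ Θ x` in `∫ -(g·h)`; `g (Θ x) = -g x`
  have key := hΘ.integral_comp hemb (fun y => -(g y * h y))
  simp only [hodd, neg_mul, neg_neg, integral_neg] at key
  exact key

/-- The odd pairing identity: `∫ g (h − h∘Θ) = 2 ∫ g h` for odd `g`, `Θ`-invariant `μ`. [folklore] -/
theorem integral_mul_sub_comp (hΘ : MeasurePreserving Θ μ μ) (hΘm : Measurable Θ)
    (hinv : Function.Involutive Θ) {g h : X → ℝ} (hodd : ∀ x, g (Θ x) = -g x)
    (hg : MemLp g 2 μ) (hh : MemLp h 2 μ) :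
    ∫ x, g x * (h x - h (Θ x)) ∂μ = 2 * ∫ x, g x * h x ∂μ := by
  have hgh : Integrable (fun x => g x * h x) μ := hg.integrable_mul hh
  have hhΘ : MemLp (fun x => h (Θ x)) 2 μ := hh.comp_measurePreserving hΘ
  have hghΘ : Integrable (fun x => g x * h (Θ x)) μ := hg.integrable_mul hhΘ
  have hsplit : (fun x => g x * (h x - h (Θ x))) = fun x => g x * h x - g x * h (Θ x) := by
    funext x; ring
  rw [hsplit, integral_sub hgh hghΘ, integral_mul_comp_eq_neg hΘ hΘm hinv hodd]
  ring

/-- **Odd-sector pairing inequality**: `4 (∫ g h)² ≤ (∫ g²) · ∫ (h − h∘Θ)²` for a `Θ`-invariant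
measure, involutive measurable `Θ`, odd `g ∈ L²`, `h ∈ L²`. With `g = J_tot`, `∫ J h = D_N` this is
the one-line sufficiency of the route (OddSufficiency) and, read backwards, the template of every
lower bound on `∫ (h − h∘Θ)²`. [folklore] -/
theorem four_mul_sq_integral_le (hΘ : MeasurePreserving Θ μ μ) (hΘm : Measurable Θ)
    (hinv : Function.Involutive Θ) {g h : X → ℝ} (hodd : ∀ x, g (Θ x) = -g x)
    (hg : MemLp g 2 μ) (hh : MemLp h 2 μ) :
    4 * (∫ x, g x * h x ∂μ) ^ 2 ≤ (∫ x, g x ^ 2 ∂μ) * ∫ x, (h x - h (Θ x)) ^ 2 ∂μ := by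
  have hhΘ : MemLp (fun x => h (Θ x)) 2 μ := hh.comp_measurePreserving hΘ
  have hk : MemLp (fun x => h x - h (Θ x)) 2 μ := hh.sub hhΘ
  have hcs := sq_integral_mul_le hg hk
  rw [integral_mul_sub_comp hΘ hΘm hinv hodd hg hh] at hcs
  nlinarith [hcs]

/-- Lower-bound form: if `∫ g² ≤ V` with `0 < V` then `∫ (h − h∘Θ)² ≥ 4 (∫ g h)² / V`. [folklore] -/
theorem sq_integral_div_le_integral_sub_comp_sq (hΘ : MeasurePreserving Θ μ μ) (hΘm : Measurable Θ)
    (hinv : Function.Involutive Θ) {g h : X → ℝ} (hodd : ∀ x, g (Θ x) = -g x)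
    (hg : MemLp g 2 μ) (hh : MemLp h 2 μ) {V : ℝ} (hV : 0 < V) (hgV : ∫ x, g x ^ 2 ∂μ ≤ V) :
    4 * (∫ x, g x * h x ∂μ) ^ 2 / V ≤ ∫ x, (h x - h (Θ x)) ^ 2 ∂μ := by
  have h1 := four_mul_sq_integral_le hΘ hΘm hinv hodd hg hh
  have h0 : 0 ≤ ∫ x, (h x - h (Θ x)) ^ 2 ∂μ := integral_nonneg fun x => sq_nonneg _
  rw [div_le_iff₀ hV]
  calc 4 * (∫ x, g x * h x ∂μ) ^ 2 ≤ (∫ x, g x ^ 2 ∂μ) * ∫ x, (h x - h (Θ x)) ^ 2 ∂μ := h1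
    _ ≤ V * ∫ x, (h x - h (Θ x)) ^ 2 ∂μ := mul_le_mul_of_nonneg_right hgV h0
    _ = (∫ x, (h x - h (Θ x)) ^ 2 ∂μ) * V := mul_comm _ _

end OddPairing

/-! ## §1b specialisation to phase space: tightness of the power `N¹` and the refutation template -/

section PhaseSpaceFloor

variable {N : ℕ}

/-- Momentum reversal is an involution of phase space. [folklore] -/
theorem momentumReversal_involutive : Function.Involutive (momentumReversal N) := by
  intro x
  simp [momentumReversal_apply]

/-- **Floor / tightness lemma.** For ANY chain `P`, any momentum-reversal-invariant measure `μ` on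
phase space, any `h ∈ L²(μ)` and any odd test function `g ∈ L²(μ)` with `∫ g² ≤ V`:
`N · ∫ (h − h∘Θ)² dμ ≥ 4 N (∫ g h)² / V`. With `g = J_tot` (odd: `bondCurrent_neg_momentum`),
`∫ J_tot h = D_N → κ > 0` and `V = c N` (CurrentVarianceLinear) the right side is `→ 4κ²/c`: SI's
power of `N` cannot be improved under Fourier's law. With the causal-transport test functions of §3
the right side is predicted `≍ N`, which would refute SI. [folklore] -/
theorem oddResponse_floor (μ : Measure (PhaseSpace N))
    (hμ : MeasurePreserving (momentumReversal N) μ μ) {g h : PhaseSpace N → ℝ}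
    (hodd : ∀ x, g (x.1, -x.2) = -g x) (hg : MemLp g 2 μ) (hh : MemLp h 2 μ) {V : ℝ} (hV : 0 < V)
    (hgV : ∫ x, g x ^ 2 ∂μ ≤ V) :
    4 * (N : ℝ) * (∫ x, g x * h x ∂μ) ^ 2 / V ≤
      (N : ℝ) * ∫ x, (h x - h (x.1, -x.2)) ^ 2 ∂μ := by
  have hodd' : ∀ x, g (momentumReversal N x) = -g x := fun x => by
    rw [momentumReversal_apply]; exact hodd x
  have h1 := sq_integral_div_le_integral_sub_comp_sq hμ (momentumReversal N).measurable
    momentumReversal_involutive hodd' hg hh hV hgV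
  simp only [momentumReversal_apply] at h1
  have hN : (0 : ℝ) ≤ N := Nat.cast_nonneg N
  calc 4 * (N : ℝ) * (∫ x, g x * h x ∂μ) ^ 2 / V
      = (N : ℝ) * (4 * (∫ x, g x * h x ∂μ) ^ 2 / V) := by ring
    _ ≤ (N : ℝ) * ∫ x, (h x - h (x.1, -x.2)) ^ 2 ∂μ := mul_le_mul_of_nonneg_left h1 hN

end PhaseSpaceFloor

/-! ## §2 load-bearing hypothesis: anharmonicity (the `lam = β = 0` analogue fails)

The harmonic analogue of SI, stated for EVERY steady-state family of `pinnedChain ω₂ 0 0 γ` (so that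
it can be instantiated at the RLL Gaussian family `harmonicNESS` without proving NESS uniqueness): -/

/-- `SI` with `lam = β = 0` and without the uniqueness antecedent (which only served to identify the
family): along every steady-state family of the pinned HARMONIC chain, `N ∫ (h − h∘Θ)²` is bounded.
FALSE (numerically `a_N = 0.30 N²`; `oddResponseBoundHarmonic_false_of`). -/
def OddResponseBoundHarmonic : Prop :=
  ∀ ω₂ γ : ℝ, 0 < ω₂ → 0 < γ →
    ∀ μ : (N : ℕ) → ℝ → ℝ → Measure (PhaseSpace N),
    (∀ (N : ℕ) (T_L T_R : ℝ), 0 < T_L → 0 < T_R →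
      (pinnedChain ω₂ 0 0 γ).IsSteadyState N T_L T_R (μ N T_L T_R)) →
    ∀ T : ℝ, 0 < T → ∃ C : ℝ, ∀ (N : ℕ) (h : PhaseSpace N → ℝ), 2 ≤ N →
      (MemLp h 2 (μ N T T) ∧
        (∀ F : PhaseSpace N → ℝ, ContDiff ℝ ((⊤ : ℕ∞) : WithTop ℕ∞) F → HasCompactSupport F →
          Tendsto (fun δ : ℝ => ((∫ x, F x ∂(μ N (T + δ / 2) (T - δ / 2))) - ∫ x, F x ∂(μ N T T)) / δ)
            (𝓝[≠] 0) (𝓝 (∫ x, F x * h x ∂(μ N T T)))) ∧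
        (∀ i : Fin N, Tendsto (fun δ : ℝ =>
            ((∫ x, (pinnedChain ω₂ 0 0 γ).bondCurrent N i x ∂(μ N (T + δ / 2) (T - δ / 2))) -
              ∫ x, (pinnedChain ω₂ 0 0 γ).bondCurrent N i x ∂(μ N T T)) / δ)
            (𝓝[≠] 0) (𝓝 (∫ x, (pinnedChain ω₂ 0 0 γ).bondCurrent N i x * h x ∂(μ N T T))))) →
      MemLp (fun x : PhaseSpace N => h x - h (x.1, -x.2)) 2 (μ N T T) ∧
        (N : ℝ) * ∫ x, (h x - h (x.1, -x.2)) ^ 2 ∂(μ N T T) ≤ C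

/-- Input 1 (harmonic twin of item ResponseDensity, stmt-9144): the RLL Gaussian family
`harmonicNESS ω₂ γ` admits an `L²` linear-response density at every `N ≥ 2`, `T > 0` (Gaussian
calculus: `h = ½ x♭ᵀ B C′ B x♭ − ½ tr(B C′)`, `B = (T G)⁻¹`, `C′ = ½(C(1,0) − C(0,1))`; not yet in
tree — differentiation of Gaussian integrals in the precision matrix). -/
def HarmonicResponseDensity (ω₂ γ : ℝ) : Prop :=
  ∀ T : ℝ, 0 < T → ∀ N : ℕ, 2 ≤ N → ∃ h : PhaseSpace N → ℝ,
    MemLp h 2 (harmonicNESS ω₂ γ N T T) ∧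
    (∀ F : PhaseSpace N → ℝ, ContDiff ℝ ((⊤ : ℕ∞) : WithTop ℕ∞) F → HasCompactSupport F →
      Tendsto (fun δ : ℝ => ((∫ x, F x ∂(harmonicNESS ω₂ γ N (T + δ / 2) (T - δ / 2))) -
          ∫ x, F x ∂(harmonicNESS ω₂ γ N T T)) / δ)
        (𝓝[≠] 0) (𝓝 (∫ x, F x * h x ∂(harmonicNESS ω₂ γ N T T)))) ∧
    (∀ i : Fin N, Tendsto (fun δ : ℝ =>
        ((∫ x, (pinnedChain ω₂ 0 0 γ).bondCurrent N i x ∂(harmonicNESS ω₂ γ N (T + δ / 2) (T - δ / 2))) -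
          ∫ x, (pinnedChain ω₂ 0 0 γ).bondCurrent N i x ∂(harmonicNESS ω₂ γ N T T)) / δ)
        (𝓝[≠] 0) (𝓝 (∫ x, (pinnedChain ω₂ 0 0 γ).bondCurrent N i x * h x ∂(harmonicNESS ω₂ γ N T T))))

/-- Input 2 (harmonic twin of item CurrentVarianceLinear for ONE bond): the first bond current has
`N`-uniformly bounded second moment in the equal-temperature (Gibbs) Gaussian state. (Value:
`∫ j₀² dμ_T = ¼ · 2T · T (e₁−e₀)ᵀ Φ_N⁻¹ (e₁−e₀) ≤ T²/ω₂`; a fourth Gaussian moment, not yet in tree.) -/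
def HarmonicCurrentVariance (ω₂ γ : ℝ) : Prop :=
  ∀ T : ℝ, 0 < T → ∃ K : ℝ, ∀ N : ℕ, ∀ hN : 2 ≤ N,
    MemLp ((pinnedChain ω₂ 0 0 γ).bondCurrent N ⟨0, by omega⟩) 2 (harmonicNESS ω₂ γ N T T) ∧
    ∫ x, (pinnedChain ω₂ 0 0 γ).bondCurrent N ⟨0, by omega⟩ x ^ 2 ∂(harmonicNESS ω₂ γ N T T) ≤ K

/-- Tilted measures inherit the invariance of the base measure under a symmetry of the tilt.
[folklore] -/
theorem measurePreserving_tilted {X : Type*} [MeasurableSpace X] {μ : Measure X} {Θ : X → X}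
    (hΘ : MeasurePreserving Θ μ μ) (hemb : MeasurableEmbedding Θ) {f : X → ℝ}
    (hf : ∀ x, f (Θ x) = f x) : MeasurePreserving Θ (μ.tilted f) (μ.tilted f) := by
  refine ⟨hemb.measurable, Measure.ext fun s hs => ?_⟩
  rw [Measure.map_apply hemb.measurable hs, Measure.tilted, withDensity_apply _ (hemb.measurable hs),
    withDensity_apply _ hs]
  have key := hΘ.setLIntegral_comp_preimage_emb hemb
    (fun x => ENNReal.ofReal (Real.exp (f x) / ∫ x, Real.exp (f x) ∂μ)) s
  simpa only [hf] using key

section Harmonic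

variable {ω₂ γ : ℝ}

/-- The precision matrix of the equal-temperature RLL state is block diagonal:
`C(T,T)⁻¹ = [[Φ/T, 0], [0, 1/T]]` (Gibbs at temperature `T`). [folklore] -/
theorem chainCov_self_inv (hω : 0 < ω₂) (hγ : 0 < γ) (N : ℕ) {T : ℝ} (hT : 0 < T) :
    (chainCov ω₂ γ N T T)⁻¹ =
      Matrix.fromBlocks (T⁻¹ • forceMatrix ω₂ N) 0 0 (T⁻¹ • (1 : Matrix (Fin N) (Fin N) ℝ)) := by
  rw [chainCov_self hω hγ N T]
  apply Matrix.inv_eq_right_inv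
  have hunit : IsUnit (forceMatrix ω₂ N).det :=
    (Matrix.isUnit_iff_isUnit_det _).mp (forceMatrix_posDef hω N).isUnit
  have h2 : (forceMatrix ω₂ N)⁻¹ * forceMatrix ω₂ N = 1 := Matrix.nonsing_inv_mul _ hunit
  rw [gibbsCov, Matrix.smul_mul, Matrix.fromBlocks_multiply]
  simp only [Matrix.mul_smul, Matrix.zero_mul, Matrix.mul_zero, add_zero, zero_add, Matrix.one_mul,
    h2, smul_zero]
  ext a b
  rcases a with i | i <;> rcases b with j | j <;>
    simp [Matrix.one_apply, hT.ne']

/-- A block-diagonal quadratic form is even under momentum reversal. [folklore] -/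
theorem quadForm_fromBlocks_diag_neg {N : ℕ} (A D : Matrix (Fin N) (Fin N) ℝ) (x : PhaseSpace N) :
    quadForm (Matrix.fromBlocks A 0 0 D) (x.1, -x.2) = quadForm (Matrix.fromBlocks A 0 0 D) x := by
  simp only [quadForm, flat, Matrix.fromBlocks_mulVec, Sum.elim_comp_inl, Sum.elim_comp_inr,
    Matrix.zero_mulVec, add_zero, zero_add, neg_zero, sumElim_dotProduct_sumElim, Matrix.mulVec_neg,
    dotProduct_neg, neg_dotProduct, neg_neg]

/-- **The equal-temperature RLL state is momentum-reversal invariant** (it is the Gibbs Gaussian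
`∝ exp(−(qᵀΦq + pᵀp)/2T)`). [Bonetto–Lebowitz–Lukkarinen 2004, §2] [folklore] -/
theorem measurePreserving_momentumReversal_harmonicNESS (hω : 0 < ω₂) (hγ : 0 < γ) (N : ℕ)
    {T : ℝ} (hT : 0 < T) :
    MeasurePreserving (momentumReversal N) (harmonicNESS ω₂ γ N T T) (harmonicNESS ω₂ γ N T T) := by
  rw [harmonicNESS, chainCov_self_inv hω hγ N hT, gaussMeasure]
  exact measurePreserving_tilted (measurePreserving_momentumReversal N)
    (momentumReversal N).measurableEmbedding
    (fun x => by rw [momentumReversal_apply, quadForm_fromBlocks_diag_neg])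

/-- **The harmonic analogue of SI fails** (load-bearing lemma for `0 < lam ∨ 0 < β`), modulo the two
Gaussian inputs `HarmonicResponseDensity` (existence of the response density of the RLL family) and
`HarmonicCurrentVariance` (one fourth moment). Mechanism: the predicate forces
`∫ j₀ h_N dμ_T = c_N` (the flux is `c_N δ` exactly, `integral_bondCurrent_harmonicNESS_eq_fluxCoeff'`,
uniqueness of limits along `𝓝[≠] 0`), `μ_T` is `Θ`-invariant
(`measurePreserving_momentumReversal_harmonicNESS`), `j₀` is odd (`bondCurrent_neg_momentum`), so
`oddResponse_floor` gives `a_N ≥ 4 N c_N² / K`, while `c_N → c_∞ > 0` (`tendsto_fluxCoeff`,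
`fluxLimit_pos`): unbounded. Numerically `a_N = 0.30 N²` (`ω₂ = γ = T = 1`). [folklore] -/
theorem oddResponseBoundHarmonic_false_of (hω : 0 < ω₂) (hγ : 0 < γ)
    (hRD : HarmonicResponseDensity ω₂ γ) (hCV : HarmonicCurrentVariance ω₂ γ) :
    ¬ OddResponseBoundHarmonic := by
  intro hSI
  obtain ⟨C, hC⟩ := hSI ω₂ γ hω hγ (fun N T_L T_R => harmonicNESS ω₂ γ N T_L T_R)
    (fun N T_L T_R hL hR => isSteadyState_harmonicNESS hω hγ N hL hR) 1 one_pos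
  obtain ⟨K, hK⟩ := hCV 1 one_pos
  set c := fluxLimit ω₂ γ with hc
  have hcpos : 0 < c := fluxLimit_pos hω hγ
  have hKpos : 0 < max K 1 := lt_of_lt_of_le one_pos (le_max_right K 1)
  have hev1 : ∀ᶠ N : ℕ in atTop, c / 2 < fluxCoeff ω₂ γ N :=
    (tendsto_fluxCoeff hω hγ).eventually_const_lt (by linarith)
  have hev2 : ∀ᶠ N : ℕ in atTop, 2 ≤ N := eventually_ge_atTop 2
  have hev3 : ∀ᶠ N : ℕ in atTop, (C + 1) * max K 1 / c ^ 2 < (N : ℝ) :=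
    (tendsto_natCast_atTop_atTop (R := ℝ)).eventually_gt_atTop _
  obtain ⟨N, hN1, hN2, hN3⟩ := (hev1.and (hev2.and hev3)).exists
  obtain ⟨h, hmem, hF, hcur⟩ := hRD 1 one_pos N hN2
  obtain ⟨_, hbound⟩ := hC N h hN2 ⟨hmem, hF, hcur⟩
  obtain ⟨hjmem, hjK⟩ := hK N hN2
  have h01 : (⟨0, by omega⟩ : Fin N).val + 1 < N := by simp; omega
  -- the pairing of `h` with the first bond current is the flux coefficient
  have hresp : ∫ x, (pinnedChain ω₂ 0 0 γ).bondCurrent N ⟨0, by omega⟩ x * h x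
      ∂(harmonicNESS ω₂ γ N 1 1) = fluxCoeff ω₂ γ N := by
    have ht := hcur ⟨0, by omega⟩
    have hEq : (fun δ : ℝ =>
        ((∫ x, (pinnedChain ω₂ 0 0 γ).bondCurrent N ⟨0, by omega⟩ x
            ∂(harmonicNESS ω₂ γ N (1 + δ / 2) (1 - δ / 2))) -
          ∫ x, (pinnedChain ω₂ 0 0 γ).bondCurrent N ⟨0, by omega⟩ x ∂(harmonicNESS ω₂ γ N 1 1)) / δ)
        =ᶠ[𝓝[≠] 0] fun _ => fluxCoeff ω₂ γ N := by
      have hball : Set.Ioo (-1 : ℝ) 1 ∈ 𝓝 (0 : ℝ) := Ioo_mem_nhds (by norm_num) (by norm_num)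
      filter_upwards [mem_nhdsWithin_of_mem_nhds hball, self_mem_nhdsWithin] with δ hδ hδ0
      have hL : (0 : ℝ) < 1 + δ / 2 := by obtain ⟨h1, h2⟩ := hδ; linarith
      have hR : (0 : ℝ) < 1 - δ / 2 := by obtain ⟨h1, h2⟩ := hδ; linarith
      have hδ0' : δ ≠ 0 := hδ0
      rw [integral_bondCurrent_harmonicNESS_eq_fluxCoeff' hω hγ hL hR _ h01,
        integral_bondCurrent_harmonicNESS_eq_fluxCoeff' hω hγ one_pos one_pos _ h01]
      field_simp
      ring
    exact tendsto_nhds_unique (ht.congr' hEq) tendsto_const_nhds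
  -- the floor from §1b with `g = j₀`, `V = max K 1`
  have hjK' : ∫ x, (pinnedChain ω₂ 0 0 γ).bondCurrent N ⟨0, by omega⟩ x ^ 2
      ∂(harmonicNESS ω₂ γ N 1 1) ≤ max K 1 := hjK.trans (le_max_left K 1)
  have hfloor := oddResponse_floor (harmonicNESS ω₂ γ N 1 1)
    (measurePreserving_momentumReversal_harmonicNESS hω hγ N one_pos)
    (fun x => (pinnedChain ω₂ 0 0 γ).bondCurrent_neg_momentum N ⟨0, by omega⟩ x) hjmem hmem hKpos hjK'
  rw [hresp] at hfloor
  have hle : 4 * (N : ℝ) * (fluxCoeff ω₂ γ N) ^ 2 / max K 1 ≤ C := hfloor.trans hbound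
  have h5 : C + 1 < (N : ℝ) * c ^ 2 / max K 1 := by
    rw [lt_div_iff₀ hKpos]
    have h3 := hN3
    rw [div_lt_iff₀ (by positivity)] at h3
    linarith
  have h6 : (N : ℝ) * c ^ 2 / max K 1 ≤ 4 * (N : ℝ) * (fluxCoeff ω₂ γ N) ^ 2 / max K 1 := by
    apply div_le_div_of_nonneg_right _ hKpos.le
    have hN0 : (0 : ℝ) ≤ N := Nat.cast_nonneg N
    have hcN : c / 2 < fluxCoeff ω₂ γ N := hN1
    have hsq : c ^ 2 ≤ 4 * (fluxCoeff ω₂ γ N) ^ 2 := by nlinarith [hcN, hcpos]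
    nlinarith [hsq, hN0]
  linarith

end Harmonic

/-! ## §3 the deterministic-bulk echo floor: SI contradicts an equilibrium `N²`-floor on the odd Kubo corrector

The exact logical shape of a disproof along the causal-transport line. `EquilibriumEchoFloor` is an
EQUILIBRIUM statement about the open chain at temperature `T` (no NESS, no `h`): the odd part of the
Kubo corrector `u_N = ∫₀^∞ P_t J_tot dt` has `‖u_N − u_N∘Θ‖²_{L²(Gibbs_T)} ≥ c N²` for large `N`.
Heuristically (§3 of the header) `‖u−uΘ‖² ≈ 4bN²κT²(1−2vb)` for a deterministic normal conductor
(Green–Kubo + finite signal speed), `≍ N³` for the harmonic chain, and only `≍ N` for a stochastic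
bulk; the MD job `kitjob2/echo_floor_md.py` (j008869) estimates the lower bound
`‖u−uΘ‖² ≥ 4A²/‖Y‖²` directly. Together with three SUPPORT items of this very route (NessUnique,
ResponseDensity, OddDensityIsCorrector) it refutes the crux: the route is self-defeating if its
own McLennan calculus holds and the chain conducts normally with a deterministic bulk. -/

/-- `EquilibriumEchoFloor ω₂ lam β γ T`: for some `c > 0` and all large `N`, EVERY `u ∈ L²(Gibbs_T)`
that is Gibbs-a.e. the `τ → ∞` limit of `∫₀^τ (P_t J_tot)(x) dt` (the Kubo corrector of the
equilibrium open chain, `P_t` = `transitionKernel N T T t`) has `c N² ≤ ∫ (u − u∘Θ)² dGibbs_T`.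
Vacuous where the corrector does not exist; version-independent (a.e. limits are a.e. unique). -/
def EquilibriumEchoFloor (ω₂ lam β γ T : ℝ) : Prop :=
  ∃ c : ℝ, 0 < c ∧ ∃ N₀ : ℕ, ∀ N : ℕ, N₀ ≤ N → ∀ u : PhaseSpace N → ℝ,
    MemLp u 2 ((pinnedChain ω₂ lam β γ).gibbsMeasure N T) →
    (∀ᵐ x ∂((pinnedChain ω₂ lam β γ).gibbsMeasure N T), Tendsto (fun τ : ℝ => ∫ t in Set.Ioc (0 : ℝ) τ,
        (∫ y, (∑ i : Fin N, (pinnedChain ω₂ lam β γ).bondCurrent N i y)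
          ∂((pinnedChain ω₂ lam β γ).transitionKernel N T T t.toNNReal x))) atTop (𝓝 (u x))) →
    c * (N : ℝ) ^ 2 ≤ ∫ x, (u x - u (x.1, -x.2)) ^ 2 ∂((pinnedChain ω₂ lam β γ).gibbsMeasure N T)

/-- **SI is false if the equilibrium echo floor holds**, given the route's own support items
NessUnique (to discharge SI's antecedent and identify `μ_{N,T,T}` with Gibbs —
`pinnedChain_isSteadyState_gibbsMeasure`), ResponseDensity (SI is vacuous without an `h`) and
OddDensityIsCorrector (`h − h∘Θ = (u − u∘Θ)/((N−1)T²)`): then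
`a_N = N ∫(u−uΘ)²/((N−1)²T⁴) ≥ c N / T⁴ → ∞`. [folklore] -/
theorem oddResponseBound_false_of_echoFloor {ω₂ lam β γ T : ℝ} (hω : 0 < ω₂) (hl : 0 < lam)
    (hβ : 0 < β) (hγ : 0 < γ) (hT : 0 < T) (hE : EquilibriumEchoFloor ω₂ lam β γ T)
    (hU : NessUnique) (hR : ResponseDensity) (hO : OddDensityIsCorrector) : ¬ OddResponseBound := by
  intro hSI
  have hUq := hU ω₂ lam β γ hω hl hβ hγ
  -- a steady-state family (existence is PROVED in tree; choice)
  obtain ⟨μ₀, hμ₀⟩ : ∃ μ₀ : (N : ℕ) → ℝ → ℝ → Measure (PhaseSpace N),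
      ∀ (N : ℕ) (T_L T_R : ℝ), 0 < T_L → 0 < T_R →
        (pinnedChain ω₂ lam β γ).IsSteadyState N T_L T_R (μ₀ N T_L T_R) := by
    classical
    refine ⟨fun N T_L T_R => if h : 0 < T_L ∧ 0 < T_R then
      Classical.choose (pinnedChain_exists_isSteadyState hω hl hβ hγ N h.1 h.2) else 0, ?_⟩
    intro N T_L T_R h1 h2
    simp only [dif_pos (And.intro h1 h2)]
    exact Classical.choose_spec (pinnedChain_exists_isSteadyState hω hl hβ hγ N h1 h2)
  obtain ⟨C, hC⟩ := hSI ω₂ lam β γ hω hl hβ hγ hUq μ₀ hμ₀ T hT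
  obtain ⟨c, hc, N₀, hN₀⟩ := hE
  have hev1 : ∀ᶠ N : ℕ in atTop, N₀ ≤ N := eventually_ge_atTop N₀
  have hev2 : ∀ᶠ N : ℕ in atTop, 2 ≤ N := eventually_ge_atTop 2
  have hev3 : ∀ᶠ N : ℕ in atTop, C * T ^ 4 / c < (N : ℝ) :=
    (tendsto_natCast_atTop_atTop (R := ℝ)).eventually_gt_atTop _
  obtain ⟨N, hNN₀, hN2, hN3⟩ := (hev1.and (hev2.and hev3)).exists
  obtain ⟨h, hmem, hF, hcur⟩ := hR ω₂ lam β γ hω hl hβ hγ hUq μ₀ hμ₀ T hT N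
  obtain ⟨_, hbound⟩ := hC N h hN2 ⟨hmem, hF, hcur⟩
  obtain ⟨u, hu2, hlim, hident⟩ := hO ω₂ lam β γ hω hl hβ hγ hUq μ₀ hμ₀ T hT N h hN2 ⟨hmem, hF, hcur⟩
  -- under uniqueness the equal-temperature member of the family IS the Gibbs measure
  have hG : μ₀ N T T = (pinnedChain ω₂ lam β γ).gibbsMeasure N T :=
    hUq N T T hT hT _ _ (hμ₀ N T T hT hT)
      (pinnedChain_isSteadyState_gibbsMeasure hω hl.le hβ.le γ N hT)
  rw [hG] at hu2 hlim hident hbound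
  have hfl := hN₀ N hNN₀ u hu2 hlim
  -- ∫ (h−hΘ)² = ∫ (u−uΘ)² / ((N−1)T²)²
  have heq : ∫ x, (h x - h (x.1, -x.2)) ^ 2 ∂((pinnedChain ω₂ lam β γ).gibbsMeasure N T) =
      (∫ x, (u x - u (x.1, -x.2)) ^ 2 ∂((pinnedChain ω₂ lam β γ).gibbsMeasure N T)) /
        (((N : ℝ) - 1) * T ^ 2) ^ 2 := by
    rw [← integral_div]
    refine integral_congr_ae ?_
    filter_upwards [hident] with x hx
    rw [hx, div_pow]
  rw [heq] at hbound
  set I := ∫ x, (u x - u (x.1, -x.2)) ^ 2 ∂((pinnedChain ω₂ lam β γ).gibbsMeasure N T) with hI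
  have hN2r : (2 : ℝ) ≤ N := by exact_mod_cast hN2
  have hNpos : (0 : ℝ) < N := by linarith
  have hden : 0 < (((N : ℝ) - 1) * T ^ 2) ^ 2 := by
    have : 0 < ((N : ℝ) - 1) * T ^ 2 := by
      have : (0 : ℝ) < (N : ℝ) - 1 := by linarith
      positivity
    positivity
  -- N · c N² / ((N−1)T²)² ≤ C
  have h1 : (N : ℝ) * (c * (N : ℝ) ^ 2 / (((N : ℝ) - 1) * T ^ 2) ^ 2) ≤ C := by
    refine le_trans ?_ hbound
    apply mul_le_mul_of_nonneg_left _ hNpos.le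
    exact div_le_div_of_nonneg_right hfl hden.le
  -- c N / T⁴ ≤ N · c N² / ((N−1)T²)²   (as (N−1)² ≤ N²)
  have h2 : c * (N : ℝ) / T ^ 4 ≤ (N : ℝ) * (c * (N : ℝ) ^ 2 / (((N : ℝ) - 1) * T ^ 2) ^ 2) := by
    have hT4 : (0 : ℝ) < T ^ 4 := by positivity
    have hA : c * (N : ℝ) / T ^ 4 = (N : ℝ) * (c * (N : ℝ) ^ 2 / ((N : ℝ) ^ 2 * T ^ 4)) := by
      field_simp
    have hB : c * (N : ℝ) ^ 2 / ((N : ℝ) ^ 2 * T ^ 4) ≤ c * (N : ℝ) ^ 2 / (((N : ℝ) - 1) * T ^ 2) ^ 2 := by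
      apply div_le_div_of_nonneg_left (by positivity) hden
      have hle : ((N : ℝ) - 1) ^ 2 ≤ (N : ℝ) ^ 2 := by nlinarith
      calc (((N : ℝ) - 1) * T ^ 2) ^ 2 = ((N : ℝ) - 1) ^ 2 * T ^ 4 := by ring
        _ ≤ (N : ℝ) ^ 2 * T ^ 4 := mul_le_mul_of_nonneg_right hle hT4.le
    rw [hA]
    exact mul_le_mul_of_nonneg_left hB hNpos.le
  have h3 : C < c * (N : ℝ) / T ^ 4 := by
    rw [lt_div_iff₀ (by positivity)]
    have h4 := hN3
    rw [div_lt_iff₀ hc] at h4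
    linarith
  linarith

end Summit.AtomisticToContinuum.FouriersLaw.Cruxes.OddResponseBound.Disproof
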